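import Summits.BirchSwinnertonDyer.BirchSwinnertonDyer.Theorems.PrintCf2SplitBadTwoRestrictedSelmerControlSkeleton
import Literature.NumberTheory.EllipticCurves.Agboola2007.RestrictedSelmerDualProofs
import Literature.NumberTheory.EllipticCurves.AdditiveReductionSemistableModelProofs
import HarnessLib

/-!
# Crux `PrintCf2.SplitBadTwoRankOneOfFacts` (stmt-BirchSwinnertonDyer-20368), road α v9 — brick B5″:
# the LEADING-TERM (Γ-Euler-characteristic) step for Agboola's `X_𝔮(K_∞, M)` — the top of S3c `stub_restrictedControl_two`

Cell `bsd-print-cf2`, width seat `bsd-line-cf2-p1-w7` g0; `--supports stmt-BirchSwinnertonDyer-20368` (helper, Theses-free).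
HONEST FRAMING: nothing here closes a crux or a stub; BSD is not proved by any of this; no summit statement is proved
by this seat. No definition, no named fact, no `sorry`. Third file of the seat's descent skeleton for road α's
algebraic half (v9, LEAD g10: S3b = S3b′ `stub_restrictedMainConj_two` ∘ S3c `stub_restrictedControl_two`, typed on
`Agboola2007.RestrictedDualData κ M 𝔮 γ` with the shape `D.HasCharValuationAt n`): TOP (this file) → CONTROL
(`…RestrictedSelmerControlSkeleton`, p649994) → BOTTOM (`…RestrictedSelmerPair{Skeleton,Base}`, p648601 / p649193).

WHAT IS PROVED (generic: `K` a number field, `κ` any `ℤ_p`-extension with topological generator `γ`, `M` a discrete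
`p`-primary `Γ_K`-module with open stabilisers, `𝔮` any place; for road α `K = K₀`, `p = 2`, `κ = κ*` unramified outside
`v̄`, `M = W* = ↥((W.baseChange K₀).endEigenPrimaryTorsion 2 π r)`, `𝔮 = v̄`):
* §1 `Λ`-algebra: `finite_coinvariants_of_constantCoeff_ne_zero` — for `X` finitely generated torsion with `char(X) = (f)`,
  `f(0) ≠ 0 ⟹ X[T]`, `X/TX` finite (converse half of Greenberg's Lemma 4.2, from the tree's `order_eq_toNat_lengthAt` and
  `card_coinvariants_of_lengthAt_eq_zero`); `padicValNat_card_of_constantCoeff_mul_eq` (valuation bookkeeping);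
* §2 `finite_endInvariants_of_hasCharValuationAt`, `padicValNat_card_endInvariants_of_hasCharValuationAt` — on top of
  the LEAD's `Agboola2007/RestrictedSelmerDualProofs.lean` (landed 17:00Z while this file was being written:
  `RestrictedDualData.isDualPair`, Lemma 4.2 `constantCoeff_charGenerator_mul_natCard`, `HasCharValuationAt.pow_mul_natCard`
  — all WITH the hypothesis `𝔖^Γ finite`): **from S3c's displayed hypothesis `D.HasCharValuationAt n` ALONE
  (+ `Module.Finite Λ D.X`): `𝔖^Γ`, `𝔖_Γ` are finite and `v_p #𝔖_𝔮(K_∞, M)^Γ = n + v_p #𝔖_𝔮(K_∞, M)_Γ`** — the number `n`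
  of S3c is the `Γ`-Euler characteristic of the restricted Selmer group, finiteness included;
* §3 `mem_endInvariants_conjRestricted_iff`, `resOfLe_mem_endInvariants_conjRestricted`,
  `resOfLe_eq_zero_iff_of_mem_restrictedSelmerBase` — the bottom control map `𝔖_𝔮(K, M) → 𝔖_𝔮(K_∞, M)` of brick B5′
  lands in exactly this `𝔖^Γ`, with kernel `𝔖_𝔮(K, M) ∩ ker (H¹(K, M) → H¹(K_∞, M))`.

NOT PROVED HERE (the remaining displayed content of S3c, values not skeletons): finite generation of `X_𝔮(K*_∞, W*)`;
`#𝔖_Γ` (Agboola §5); the control INDEX (B5′ gives finite kernel + local cokernel, not their orders); `#𝔖_{𝔭*}(K, W*)`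
↔ `#Ш(E/K)[𝔭*^∞] · [E(K_{𝔭*}) ⊗ : loc]` (Agboola §6, Prop. 8.1; Poitou–Tate); the `K ↔ ℚ` repackaging (B4/B6) and the
dyadic local values (B2/B7). presearch: not applicable (no stub, no fact filed; Greenberg LNM 1716 §4 Lemma 4.2,
Coates–Schneider–Sujatha 2003 §3, Agboola 2007 §5 — all typed generically in the tree's `IwasawaEulerChar*Proofs`).

References: A. Agboola, Compositio Math. 143 (2007) = arXiv:math/0602192, §1 p. 2, §3, §5, Thm. 2 [Agboola2007];
R. Greenberg, LNM 1716 (1999) §1 p. 60, §3, §4 Lemma 4.2 [GreenbergLNM1716]; J. Coates, P. Schneider, R. Sujatha, Doc.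
Math. Extra Vol. Kato (2003) §3 (30)–(31) [CoatesSchneiderSujatha2003].
-/

noncomputable section

open scoped Classical

set_option linter.dupNamespace false
set_option autoImplicit false

open NumberField IsDedekindDomain Field
open Literature.NumberTheory.EllipticCurves
open Literature.NumberTheory.EllipticCurves.Agboola2007
open Literature.NumberTheory.EllipticCurves.IwasawaAlgebra
open Literature.NumberTheory.EllipticCurves.IwasawaDual
open Literature.NumberTheory.GaloisRepresentations

universe u

namespace Summit.BirchSwinnertonDyer.BirchSwinnertonDyer.Theorems.PrintCf2.RestrictedSelmerPair

/-! ## §1. `Λ`-side: `f(0) ≠ 0 ⟹ X/TX` finite (the converse half of Greenberg's Lemma 4.2) -/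

section Lambda

variable {p : ℕ} [Fact p.Prime] (X : Type u) [AddCommGroup X] [Module (IwasawaAlgebra p) X]
  [Module.Finite (IwasawaAlgebra p) X]

/-- **`f(0) ≠ 0 ⟹ X[T]` and `X/TX` finite** for a finitely generated torsion `Λ`-module `X` with `char(X) = (f)`
(the converse half of Greenberg's Lemma 4.2: "one sees that `X/TX` is finite if and only if `f(0) ≠ 0`"): `f(0) ≠ 0`
gives `ord_T f = 0`, `ord_T f = ℓ_{(T)}(X)` (`order_eq_toNat_lengthAt`), and `ℓ_{(T)}(X) = 0` gives both finiteness
statements (`card_coinvariants_of_lengthAt_eq_zero`). [cite: GreenbergLNM1716, §4 Lemma 4.2 (p. 103)] -/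
theorem finite_coinvariants_of_constantCoeff_ne_zero (hX : Module.IsTorsion (IwasawaAlgebra p) X)
    (f : IwasawaAlgebra p) (hf : Module.charIdeal (IwasawaAlgebra p) X = Ideal.span {f})
    (hf0 : PowerSeries.constantCoeff f ≠ 0) :
    Finite (invariants p X) ∧ Finite (coinvariants p X) := by
  have hord : f.order = 0 := by
    rw [show (0 : ℕ∞) = ((0 : ℕ) : ℕ∞) from rfl, PowerSeries.order_eq_nat]
    refine ⟨?_, fun i hi ↦ (Nat.not_lt_zero i hi).elim⟩
    rwa [PowerSeries.coeff_zero_eq_constantCoeff]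
  have hlen := order_eq_toNat_lengthAt p hX f hf (primeT p) (primeT_asIdeal p)
  rw [hord] at hlen
  have h0 : Module.lengthAt (IwasawaAlgebra p) X (primeT p) = 0 := by
    have hne := lengthAt_primeT_ne_top X hX
    have htoNat : (Module.lengthAt (IwasawaAlgebra p) X (primeT p)).toNat = 0 := by
      exact_mod_cast hlen.symm
    rcases ENat.toNat_eq_zero.mp htoNat with h | h
    · exact h
    · exact (hne h).elim
  obtain ⟨h1, h2, -⟩ := card_coinvariants_of_lengthAt_eq_zero X hX h0
  exact ⟨h1, h2⟩

/-- Valuation bookkeeping: from `a₀ · a = u · b` in `ℤ_p` (`a₀ ≠ 0`, `u` a unit, `a, b ≠ 0` naturals) read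
`ord_p a₀ + v_p(a) = v_p(b)` (`PadicInt.valuation_mul`, `Padic.valuation_natCast`). [folklore] -/
theorem padicValNat_eq_of_mul_natCast_eq {a₀ : ℤ_[p]} {u : ℤ_[p]ˣ} {a b : ℕ}
    (ha : a ≠ 0) (hb : b ≠ 0) (ha₀ : a₀ ≠ 0) (h : a₀ * (a : ℤ_[p]) = u * b) :
    a₀.valuation + padicValNat p a = padicValNat p b := by
  have hnat : ∀ n : ℕ, (n : ℤ_[p]).valuation = padicValNat p n := fun n ↦ by
    have e := PadicInt.valuation_coe (n : ℤ_[p])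
    rw [PadicInt.coe_natCast, Padic.valuation_natCast] at e
    exact_mod_cast e.symm
  have ha' : (a : ℤ_[p]) ≠ 0 := Nat.cast_ne_zero.mpr ha
  have hb' : (b : ℤ_[p]) ≠ 0 := Nat.cast_ne_zero.mpr hb
  have hu0 : (u : ℤ_[p]) ≠ 0 := u.ne_zero
  have e := congrArg PadicInt.valuation h
  rw [PadicInt.valuation_mul ha₀ ha', PadicInt.valuation_mul hu0 hb', hnat, hnat,
    padicInt_valuation_eq_zero_of_isUnit u.isUnit, zero_add] at e
  exact e

end Lambda

/-! ## §2. From S3c's hypothesis `D.HasCharValuationAt n` ALONE to the finiteness of `𝔖^Γ`, `𝔖_Γ` and `v_p #𝔖^Γ = n + v_p #𝔖_Γ` -/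

section Dual

variable {K : Type u} [Field K] [NumberField K] {p : ℕ} [Fact p.Prime] {κ : ZpExtension K p}
  {M : Type u} [AddCommGroup M] [DistribMulAction (absoluteGaloisGroup K) M]
  [TopologicalSpace M] [DiscreteTopology M] {𝔮 : HeightOneSpectrum (𝓞 K)} {γ : absoluteGaloisGroup K}

/-- **S3c's hypothesis ALONE forces finiteness** (no `𝔖^Γ finite` input): if `D.HasCharValuationAt n` (LEAD's shape
«`X_𝔮` is `Λ`-torsion, `char = (H)`, `H(0) ≠ 0`, `ord_p H(0) = n`», the displayed hypothesis of v9's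
`stub_restrictedControl_two`) and `D.X` is finitely generated over `Λ`, then `𝔖_𝔮(K_∞, M)^Γ` AND `𝔖_𝔮(K_∞, M)_Γ` are FINITE
(`f(0) ≠ 0 ⟹ X/TX`, `X[T]` finite by §1, then Pontryagin duality `#X/TX = #𝔖^Γ`, `#X[T] = #𝔖_Γ` through
`RestrictedDualData.isDualPair`, `Agboola2007/RestrictedSelmerDualProofs.lean`). Complements the LEAD's `HasCharValuationAt.pow_mul_natCard`, which takes
`𝔖^Γ` finite as a hypothesis. NB finite generation of `X` is NOT part of `HasCharValuationAt` (for `M = W*` it is the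
cofinite generation of `𝔖_{𝔭*}(K*_∞, W*)`; Nakayama form: `RestrictedDualData.module_finite_of_finite`).
[cite: GreenbergLNM1716, §4 Lemma 4.2 (p. 103)] [cite: Agboola2007, §5 (arXiv p0012:L8–16)] -/
theorem finite_endInvariants_of_hasCharValuationAt (D : RestrictedDualData κ M 𝔮 γ)
    (htor : ∀ m : M, ∃ k : ℕ, p ^ k • m = 0)
    (hstab : ∀ m : M, IsOpen (MulAction.stabilizer (absoluteGaloisGroup K) m : Set (absoluteGaloisGroup K)))
    (hγ : κ.IsTopGenerator γ) [Module.Finite (IwasawaAlgebra p) D.X] {n : ℕ}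
    (h : D.HasCharValuationAt n) :
    Finite (endInvariants (conjRestricted κ M 𝔮 γ - 1)) ∧
      Finite (EndCoinvariants (conjRestricted κ M 𝔮 γ - 1)) := by
  obtain ⟨hX, f, hf, hf0, -⟩ := h
  have hp := D.isDualPair htor hstab hγ
  obtain ⟨hinv, hcoinv⟩ := finite_coinvariants_of_constantCoeff_ne_zero D.X hX f hf hf0
  exact ⟨hp.finite_coinvariants_iff.mp hcoinv, hp.finite_invariants_iff.mp hinv⟩

/-- **THE TOP STEP OF S3c, hypothesis-free form: `D.HasCharValuationAt n ⟹ v_p #𝔖_𝔮(K_∞, M)^Γ = n + v_p #𝔖_𝔮(K_∞, M)_Γ`**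
(`D.X` finitely generated; `M` `p`-primary with open stabilisers; `γ` a generator): the LEAD's `p^n · #𝔖_Γ = u · #𝔖^Γ`
(`HasCharValuationAt.pow_mul_natCard`) with its finiteness hypothesis DISCHARGED by
`finite_endInvariants_of_hasCharValuationAt`, read in the `padicValNat` currency of `stub_restrictedControl_two`'s conclusion.
What remains of S3c after this: `#𝔖^Γ` via CONTROL (brick B5′: `𝔖_𝔮(K, M) → 𝔖^Γ`, finite kernel, local cokernel), `#𝔖_𝔮(K, M)`
via the bottom pair (brick B5) and Poitou–Tate (Agboola §6), `#𝔖_Γ` (Agboola §5), with their additive-`2` local values.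
[cite: Agboola2007, §5, Thm. 2 (arXiv p0004:L93–101)] [cite: GreenbergLNM1716, §4 Lemma 4.2] -/
theorem padicValNat_card_endInvariants_of_hasCharValuationAt (D : RestrictedDualData κ M 𝔮 γ)
    (htor : ∀ m : M, ∃ k : ℕ, p ^ k • m = 0)
    (hstab : ∀ m : M, IsOpen (MulAction.stabilizer (absoluteGaloisGroup K) m : Set (absoluteGaloisGroup K)))
    (hγ : κ.IsTopGenerator γ) [Module.Finite (IwasawaAlgebra p) D.X] {n : ℕ}
    (h : D.HasCharValuationAt n) :
    padicValNat p (Nat.card (endInvariants (conjRestricted κ M 𝔮 γ - 1))) =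
      n + padicValNat p (Nat.card (EndCoinvariants (conjRestricted κ M 𝔮 γ - 1))) := by
  obtain ⟨hfinI, hfinC⟩ := finite_endInvariants_of_hasCharValuationAt D htor hstab hγ h
  obtain ⟨-, u, hu⟩ := h.pow_mul_natCard htor hstab hγ hfinI
  haveI := hfinI; haveI := hfinC
  have hI : Nat.card (endInvariants (conjRestricted κ M 𝔮 γ - 1)) ≠ 0 := Nat.card_pos.ne'
  have hC : Nat.card (EndCoinvariants (conjRestricted κ M 𝔮 γ - 1)) ≠ 0 := Nat.card_pos.ne'
  have hp0 : ((p : ℤ_[p]) ^ n) ≠ 0 := pow_ne_zero _ (NeZero.ne _)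
  have e := padicValNat_eq_of_mul_natCast_eq hC hI hp0 hu
  rw [PadicInt.valuation_pow, PadicInt.valuation_p, mul_one] at e
  omega

/-! ## §3. The bottom control map lands in `𝔖_𝔮(K_∞, M)^Γ = H⁰(Γ, 𝔖_𝔮(K_∞, M))` -/

/-- `𝔖_𝔮(K_∞, M)^Γ` unfolded: `s ∈ H⁰(Γ, 𝔖)` (`endInvariants (conjRestricted γ − 1)`) iff `conj_γ s = s` in `H¹(K_∞, M)`.
[cite: Agboola2007, §3 (arXiv p0008:L76–80)] -/
theorem mem_endInvariants_conjRestricted_iff (s : restrictedSelmerZp κ M 𝔮) :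
    s ∈ endInvariants (conjRestricted κ M 𝔮 γ - 1) ↔
      conjH1 κ.kerSubgroup M γ (s : subgroupH1 κ.kerSubgroup M) = s := by
  rw [mem_endInvariants_iff, IwasawaDual.End_sub_apply, AddMonoid.End.one_apply, sub_eq_zero]
  constructor
  · intro h
    rw [← coe_conjRestricted_apply, h]
  · intro h
    exact Subtype.ext (by rw [coe_conjRestricted_apply, h])

/-- **The bottom control map lands in `H⁰(Γ, 𝔖_𝔮(K_∞, M))`**: the restriction of a class of `𝔖_𝔮(K, M)`
(`Agboola2007.restrictedSelmerBase`) is a `conj_γ`-fixed element of `𝔖_𝔮(K_∞, M)` (brick B5′ `resOfLe_mem_restrictedSelmer`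
+ `conjH1_resOfLe_of_mem`) — i.e. an element of the group `endInvariants (conjRestricted γ − 1)` counted by
`padicValNat_card_endInvariants_of_hasCharValuationAt`; its kernel is `𝔖_𝔮(K, M) ∩ ker (H¹(K, M) → H¹(K_∞, M))`
(`resOfLe_eq_zero_iff_of_mem_restrictedSelmerBase`, finite by B5′ `finite_ker_resOfLe_and_card_le` at `n = 0`).
[cite: Agboola2007, §3 Prop. 3.2, §6] [cite: GreenbergLNM1716, §3] -/
theorem resOfLe_mem_endInvariants_conjRestricted {c : subgroupH1 (⊤ : Subgroup (absoluteGaloisGroup K)) M}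
    (hc : c ∈ restrictedSelmerBase M p 𝔮) :
    (⟨resOfLe M (le_top : κ.kerSubgroup ≤ ⊤) c,
        resOfLe_mem_restrictedSelmer M p 𝔮 (le_top : κ.kerSubgroup ≤ ⊤) hc⟩ : restrictedSelmerZp κ M 𝔮) ∈
      endInvariants (conjRestricted κ M 𝔮 γ - 1) := by
  rw [mem_endInvariants_conjRestricted_iff]
  exact conjH1_resOfLe_of_mem M (le_top : κ.kerSubgroup ≤ ⊤) (Subgroup.mem_top γ) c

/-- The element of `𝔖_𝔮(K_∞, M)` attached to `c ∈ 𝔖_𝔮(K, M)` vanishes iff `c` lies in the kernel of the global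
restriction `H¹(K, M) → H¹(K_∞, M)`. [cite: GreenbergLNM1716, §3 Lemma 3.1] -/
theorem resOfLe_eq_zero_iff_of_mem_restrictedSelmerBase {c : subgroupH1 (⊤ : Subgroup (absoluteGaloisGroup K)) M}
    (hc : c ∈ restrictedSelmerBase M p 𝔮) :
    (⟨resOfLe M (le_top : κ.kerSubgroup ≤ ⊤) c,
        resOfLe_mem_restrictedSelmer M p 𝔮 (le_top : κ.kerSubgroup ≤ ⊤) hc⟩ : restrictedSelmerZp κ M 𝔮) = 0 ↔
      c ∈ (resOfLe M (le_top : κ.kerSubgroup ≤ ⊤)).ker := by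
  rw [AddMonoidHom.mem_ker, Subtype.ext_iff]
  rfl

end Dual

end Summit.BirchSwinnertonDyer.BirchSwinnertonDyer.Theorems.PrintCf2.RestrictedSelmerPair

end
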